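import Mathlib

/-!
# `SnSubsetDichotomy.HyperoctahedralSubsets`, line `spherical-rank-sieve` — meeting closed walks of one colour word share an EDGE

Helper for crux `stmt-MatrixMultiplication-8305` (lead c4; memo `Cruxes/HyperoctahedralSubsets/LeadC4-TwoSidedRate.md` §3.1).
Vocabulary of the line (as in `…GlobalHarvest`, `…SlideBound`): `μ 0, μ 1, μ 2` are the three perfect matchings (here only
`μ c * μ c = 1` is used), a based closed colour-walk of the cyclic colour word `col : Fin (k+2) → Fin 3` is
`p : Fin (k+2) → Fin n` with `μ (col i) (p i) = p (i + 1)` (indices mod `k + 2`), and the word is cyclically non-backtracking,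
`col i ≠ col (i + 1)`.

The SLIDES of the line's open core (`stub_coreLocalTriples`; twin NOTES §4, c2's `stub_slideBound`) are the meetings
`p i = q j` of two closed walks `p, q` of the same word.  This file records the one piece of local geometry a CUBIC host forces on
them: at a common vertex `v = p i = q j` the walk `p` uses the two edges of colours `col (i-1), col i` and `q` those of colours
`col (j-1), col j`; two 2-element subsets of the 3-element colour set intersect, so the two walks share an edge at `v` and hence
also its other endpoint — a meeting is never transversal, it continues one step forward or backward along each walk
(`stub_meetShareEdge`).  Consequently meetings come in runs along shared paths, traversed in parallel (repeated factor of the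
word, one phase offset) or anti-parallel (a conjugation pattern `v γ v⁻¹` in the word, offsets in arithmetic progression of
step 2); see the memo for the use.  Pure finite combinatorics. [folklore / this line]
-/

-- the project's summit namespace `Summit.MatrixMultiplication.MatrixMultiplication` repeats a component by design (D-0022)
set_option linter.dupNamespace false

namespace Summit.MatrixMultiplication.MatrixMultiplication.Theorems.HyperoctahedralSubsets

namespace MeetShareEdge

/-- Two 2-element subsets of a 3-element set intersect. [folklore] -/
theorem fin3_pigeonhole (a b c d : Fin 3) (hab : a ≠ b) (hcd : c ≠ d) :
    b = d ∨ b = c ∨ a = d ∨ a = c := by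
  revert a b c d
  decide

variable {n k : ℕ}

/-- Backward step of a closed walk: `p (i - 1) = μ (col (i - 1)) (p i)` when the colours are involutions. [folklore] -/
theorem apply_pred (μ : Fin 3 → Equiv.Perm (Fin n)) (hμ : ∀ c, μ c * μ c = 1) (col : Fin (k + 2) → Fin 3)
    {p : Fin (k + 2) → Fin n} (hp : ∀ i, μ (col i) (p i) = p (i + 1)) (i : Fin (k + 2)) :
    μ (col (i - 1)) (p i) = p (i - 1) := by
  have h := hp (i - 1)
  rw [sub_add_cancel] at h
  have hinv : ∀ c x, μ c (μ c x) = x := fun c x => by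
    have := congrArg (fun σ : Equiv.Perm (Fin n) => σ x) (hμ c)
    simpa using this
  rw [← h, hinv]

end MeetShareEdge

open MeetShareEdge in
/-- **`stub_meetShareEdge`** (lead c4, memo §3.1): two closed walks `p, q` of the same cyclically non-backtracking colour word
that meet at `p i = q j` also meet one step further along each walk, in parallel (`p (i+1) = q (j+1)` or `p (i-1) = q (j-1)`)
or anti-parallel (`p (i+1) = q (j-1)` or `p (i-1) = q (j+1)`): in a cubic 3-edge-coloured host a meeting of equal-word
trajectories is never transversal — they share an edge at every common vertex. [this line] -/
theorem stub_meetShareEdge : ∀ (n k : ℕ) (μ : Fin 3 → Equiv.Perm (Fin n)) (col : Fin (k + 2) → Fin 3) (p q : Fin (k + 2) → Fin n), (∀ c, μ c * μ c = 1) → (∀ i, col i ≠ col (i + 1)) → (∀ i, μ (col i) (p i) = p (i + 1)) → (∀ i, μ (col i) (q i) = q (i + 1)) → ∀ i j, p i = q j → (p (i + 1) = q (j + 1) ∨ p (i + 1) = q (j - 1) ∨ p (i - 1) = q (j + 1) ∨ p (i - 1) = q (j - 1)) := by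
  intro n k μ col p q hμ hcol hp hq i j hij
  -- the four edges at the common vertex `v = p i = q j`
  have hpf : p (i + 1) = μ (col i) (p i) := (hp i).symm
  have hpb : p (i - 1) = μ (col (i - 1)) (p i) := (apply_pred μ hμ col hp i).symm
  have hqf : q (j + 1) = μ (col j) (q j) := (hq j).symm
  have hqb : q (j - 1) = μ (col (j - 1)) (q j) := (apply_pred μ hμ col hq j).symm
  have hab : col (i - 1) ≠ col i := by
    have := hcol (i - 1); rwa [sub_add_cancel] at this
  have hcd : col (j - 1) ≠ col j := by
    have := hcol (j - 1); rwa [sub_add_cancel] at this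
  rcases fin3_pigeonhole (col (i - 1)) (col i) (col (j - 1)) (col j) hab hcd with h | h | h | h
  · left; rw [hpf, hqf, h, hij]
  · right; left; rw [hpf, hqb, h, hij]
  · right; right; left; rw [hpb, hqf, h, hij]
  · right; right; right; rw [hpb, hqb, h, hij]

/-- Corollary (lead c4): distinct meeting closed walks of one cyclically non-backtracking word meet in at least two
(position, position) incidences — the run structure of slides; stated as the existence of a second meeting position pair
different from `(i, j)`. [this line] -/
theorem meet_twice (n k : ℕ) (μ : Fin 3 → Equiv.Perm (Fin n)) (col : Fin (k + 2) → Fin 3)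
    (p q : Fin (k + 2) → Fin n) (hμ : ∀ c, μ c * μ c = 1) (hcol : ∀ i, col i ≠ col (i + 1))
    (hp : ∀ i, μ (col i) (p i) = p (i + 1)) (hq : ∀ i, μ (col i) (q i) = q (i + 1)) (i j : Fin (k + 2))
    (hij : p i = q j) : ∃ i' j', i' ≠ i ∧ p i' = q j' := by
  have hne : i + 1 ≠ i := by
    intro h
    have h2 := congrArg (fun x : Fin (k + 2) => (x - i : Fin (k + 2))) h
    simp only [add_sub_cancel_left, sub_self] at h2
    exact absurd (congrArg Fin.val h2) (by simp)
  have hne' : i - 1 ≠ i := by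
    intro h
    have h2 := congrArg (fun x : Fin (k + 2) => (i - x : Fin (k + 2))) h
    simp only [sub_sub_cancel, sub_self] at h2
    exact absurd (congrArg Fin.val h2) (by simp)
  rcases stub_meetShareEdge n k μ col p q hμ hcol hp hq i j hij with h | h | h | h
  · exact ⟨i + 1, j + 1, hne, h⟩
  · exact ⟨i + 1, j - 1, hne, h⟩
  · exact ⟨i - 1, j + 1, hne', h⟩
  · exact ⟨i - 1, j - 1, hne', h⟩

end Summit.MatrixMultiplication.MatrixMultiplication.Theorems.HyperoctahedralSubsets
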